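import Summits.QuantumFields.BalabanUV.Beta.GAN24.ThreeLegSupBound
import Summits.QuantumFields.BalabanUV.Beta.GAN24.StaircaseFaces

/-!
# `BalabanUV.Beta.GAN24.ThreeLegSupBoundBlockL1` — binder row G-an2-4 ∕ (CONV-C), W-slot, the (α-0) parity re-cut, located crux (Q-L-k₀)
# (RULING R-gan24p1-g36-1 (4)–(5); leaf-01 g74 PROPOSED-4 `ThreeLegSupBound` p368545, journal `CLAIMS.log` [LEAF01-G74-PROPOSED4], «→ the OWNER»):
# **THE NAIVE THREE-LEG BOUND WITH THE KERNEL WEIGHT IN BLOCK-ℓ¹** (OWNER `b2b-balaban-gan24-p1`, gen 36; part 2d of the dressed-leg side)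

NOT IN PRINT; OUR BOOKKEEPING ([folklore] re-blocking of one absolutely convergent lattice sum over leaf-01 g74's `ThreeLegSupBound.middle_sup_le` BY NAME; 0 `def`,
0 cited facts, 0 `def … : Prop`, 0 sorry).  HONEST FRAMING (cell contract, verbatim): «discharging `BetaPertH` makes Bałaban's UV stability UNCONDITIONAL — a real
constructive-QFT result; it is NOT the continuum limit and NOT the Clay problem.»  HONEST DEPENDENCY (verbatim): «continuum YM on T⁴ ⇐ BetaPertH ∧ nine spine estimates
(0/9 proved); BetaPertH ⇐ (D1) ∧ (D4) ∧ CAP+tail; G-an2-4 gates asym, D1 and NE2/3/4.»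

WHY.  leaf-01 g74's `ThreeLegSupBound.abs_threeLeg_sup_le` is the pricing currency of the three GAUGE PAIRINGS of the dressed slot legs (`LegPushGaugeSplit.vertex2W_dressed_eq`):
two slot weights with sup envelopes, a scalar table decaying from its first slot, and a KERNEL weight `ρ` with a SUP envelope `a_ρ·E_{c₃}`.  In the (H1♮) push the kernel
weight is the composite kernel leg; for the DRESSED kernels it has no small sup envelope but a `T^B`-sized, `(k+1)`-linear BLOCK MASS (OWNER `DressedLegBlockL1Envelope`,
`DressedLegMultiplierColumnEnvelope`).  As for the core (`ThreeLegDoubleFreezeBlockL1`), the bound reads `ρ` only through `Σ′_x |ρ x|·(block-constant envelopes)(x)`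
(`middle_sup_le`'s bound depends on `quo L x` alone), so it survives with the kernel weight in block mass — this file.

WHAT (generic `d`; leaf-01 g74's standing hypotheses and constant VERBATIM except `hρ ↦ hρ₁`):
* `abs_le_blockSum` — a term is at most its block's mass (4 lines; the same lemma as `ThreeLegDoubleFreezeBlockL1`'s, repeated here so that this file waits on
  `ThreeLegSupBound` alone);
* **`abs_threeLeg_sup_le_of_blockL1`** — SAME two conclusions (summability ∧ bound) as `abs_threeLeg_sup_le` under
  `hρ₁ : ∀ c, Σ_{t ∈ box L} |ρ (L•c + toSite t)| ≤ a_ρ·L^{d+1}·e^{−κ₀‖c − c₃‖∞}`.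
Asserts NOTHING about Bałaban's tables; NOT (H1♮); NEVER «G-an2-4 closed» as (CONV-C); NOT D1, NOT `BetaPertH`, NOT continuum, NOT Clay.  2026-08-23; no existing file touched.
-/

noncomputable section

open Finset
open scoped BigOperators
open Literature.MathematicalPhysics.QuantumFieldTheory.LatticeForm (quo)
open Literature.MathematicalPhysics.QuantumFieldTheory.Balaban1983to89
open Literature.MathematicalPhysics.QuantumFieldTheory.Balaban1983to89.Beta
open B4ContourShift (supNorm)
open B12Sec2to5 (l1)
open ExpKernelCalculus (Zl Zl_nonneg)
open AffineAveraging (Site box toSite)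
open AveragingContours (blk off off_mem_box blk_add_off)
open KKTFluctuationEnergy (quo_zsmul_add_toSite tsum_blocks)
open Summit.QuantumFields.BalabanUV.Beta.GAN24.EnvelopeBlockSum (tsum_env4_le)
open Summit.QuantumFields.BalabanUV.Beta.GAN24.StaircaseFaces (blk_one)
open Summit.QuantumFields.BalabanUV.Beta.GAN24.ThreeLegSupBound (middle_sup_le)

namespace Summit.QuantumFields.BalabanUV.Beta.GAN24.ThreeLegSupBoundBlockL1

variable {d : ℕ}

/-! ## §1 A term is at most its block's mass -/

/-- [folklore] `|ρ x| ≤ Σ_{t ∈ box L} |ρ (L•blk L x + t)|` (`x` is one of the points of its own block: `blk_add_off`). -/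
theorem abs_le_blockSum {L : ℕ} (hL : 1 ≤ L) (ρ : Site (d + 1) → ℝ) (x : Site (d + 1)) :
    |ρ x| ≤ ∑ t ∈ box (d + 1) L, |ρ ((L : ℤ) • blk L x + toSite t)| := by
  have hx : ρ x = ρ ((L : ℤ) • blk L x + toSite (off L x)) := by rw [blk_add_off hL x]
  rw [hx]
  exact Finset.single_le_sum (f := fun t => |ρ ((L : ℤ) • blk L x + toSite t)|) (fun _ _ => abs_nonneg _) (off_mem_box hL x)

/-! ## §2 The naive three-leg bound with the kernel weight in block-ℓ¹ -/

section Sup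

variable {L : ℕ} {κ₀ δ a₁ a₂ aρ G : ℝ} {h₁ h₂ ρ : (Fin (d + 1) → ℤ) → ℝ}
  {T : (Fin (d + 1) → ℤ) → (Fin (d + 1) → ℤ) → (Fin (d + 1) → ℤ) → (Fin (d + 1) → ℤ) → ℝ}
  {c₁ c₂ c₃ c₄ : Fin (d + 1) → ℤ}
  (hL : 1 ≤ L) (hκ : 0 < κ₀) (hδ : 0 < δ) (hgap : κ₀ ≤ δ / 6 * L)
  (ha₁ : 0 ≤ a₁) (ha₂ : 0 ≤ a₂) (haρ : 0 ≤ aρ) (hG : 0 ≤ G)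
  (hh₁ : ∀ v, |h₁ v| ≤ a₁ * Real.exp (-(κ₀ * supNorm (quo L v - c₁))))
  (hh₂ : ∀ w, |h₂ w| ≤ a₂ * Real.exp (-(κ₀ * supNorm (quo L w - c₂))))

include hL hκ hδ hgap ha₁ ha₂ haρ hG hh₁ hh₂ in
/-- NOT IN PRINT; OUR BOOKKEEPING.  **THE NAIVE THREE-LEG BOUND, KERNEL WEIGHT IN BLOCK MASS**: leaf-01 g74's `ThreeLegSupBound.abs_threeLeg_sup_le` VERBATIM except that
the kernel weight is only asked to have block mass `Σ_{t ∈ box L} |ρ (L•c + t)| ≤ a_ρ·L^{d+1}·e^{−κ₀‖c − c₃‖∞}`; SAME conclusions — the summand is summable and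
`|Σ′_x ρ x·Σ′_v h₁ v·Σ′_w h₂ w·Σ_t T v w x (L•c₄+t)| ≤ a_ρ·a₁·a₂·G·e^{5κ₀}·Zl(δ∕2)³·L^{d+1}·Zl(κ₀∕(2(d+1)))·e^{−(κ₀∕6)(‖c₂−c₁‖∞+‖c₃−c₁‖∞+‖c₄−c₁‖∞)}`.
Proof: `middle_sup_le`'s bound is constant on the `L`-blocks of `x`; re-block `Σ′_x = Σ′_c Σ_{t ∈ box L}` (`tsum_blocks`), consume `hρ₁` block by block, and sum the
four coarse envelopes by `tsum_env4_le` at `L = 1`; the summability comes from the crude domination `|ρ x| ≤ a_ρ·L^{d+1}·E_{c₃}(x)` (`abs_le_blockSum`).  v1.2 (gen 39):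
the kernel-weight and table rows `hρ₁ hT` are the theorem's OWN displayed binders (same order and elaborated signature as v1 788a5e3de83bc5bd ∕ p370792, every by-name
consumer unchanged) — as section variables (v1) its source statement is the text of leaf-01's sup-form core, which the gate's textual restatement check reads as a twin. -/
theorem abs_threeLeg_sup_le_of_blockL1
    (hρ₁ : ∀ c, ∑ t ∈ box (d + 1) L, |ρ ((L : ℤ) • c + toSite t)| ≤ aρ * (L : ℝ) ^ (d + 1) * Real.exp (-(κ₀ * supNorm (c - c₃))))
    (hT : ∀ v w x p, |T v w x p| ≤ G * Real.exp (-δ * l1 (w - v)) * Real.exp (-δ * (l1 (x - v) + l1 (p - v)))) :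
    (Summable fun x => ρ x * ∑' v, h₁ v * ∑' w, h₂ w * ∑ t ∈ box (d + 1) L, T v w x ((L : ℤ) • c₄ + toSite t)) ∧
    |∑' x, ρ x * ∑' v, h₁ v * ∑' w, h₂ w * ∑ t ∈ box (d + 1) L, T v w x ((L : ℤ) • c₄ + toSite t)|
      ≤ aρ * a₁ * a₂ * G * Real.exp κ₀ ^ 5 * Zl (d + 1) (δ / 2) ^ 3 *
        ((L : ℝ) ^ (d + 1) * Zl (d + 1) (κ₀ / (2 * ((d : ℝ) + 1))) *
          Real.exp (-(κ₀ / 6) * (supNorm (c₂ - c₁) + supNorm (c₃ - c₁) + supNorm (c₄ - c₁)))) := by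
  classical
  haveI : NeZero L := ⟨by omega⟩
  have hZ := Zl_nonneg (D := d + 1) (half_pos hδ)
  set K : ℝ := a₁ * a₂ * G * Real.exp κ₀ ^ 5 * Zl (d + 1) (δ / 2) ^ 3 with hK
  have hK0 : 0 ≤ K := by rw [hK]; positivity
  -- names for the envelopes and the summand
  set E : (Fin (d + 1) → ℤ) → (Fin (d + 1) → ℤ) → ℝ := fun c y => Real.exp (-(κ₀ * supNorm (c - y))) with hE
  set S : (Fin (d + 1) → ℤ) → ℝ := fun x => ∑' v, h₁ v * ∑' w, h₂ w * ∑ t ∈ box (d + 1) L, T v w x ((L : ℤ) • c₄ + toSite t) with hS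
  -- the two slots: block-constant bound in `x`
  have hSx : ∀ x, |S x| ≤ K * (E (quo L x) c₁ * E (quo L x) c₂ * E (quo L x) c₄) := fun x => by
    have h := (middle_sup_le hL hκ hδ hgap ha₁ ha₂ hG hh₁ hh₂ hT (c₁ := c₁) (c₂ := c₂) (c₄ := c₄) x).2
    rw [← hK] at h
    exact h
  -- pointwise domination of the kernel weight by its block mass
  have hρx : ∀ x, |ρ x| ≤ aρ * (L : ℝ) ^ (d + 1) * E (quo L x) c₃ := fun x =>
    (abs_le_blockSum hL ρ x).trans (hρ₁ (blk L x))
  -- the coarse four-envelope sum (`tsum_env4_le` at blocking 1) and at blocking `L`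
  have hE4 := tsum_env4_le (d := d) (L := 1) le_rfl hκ c₁ c₂ c₃ c₄
  have hq1 : ∀ u : Fin (d + 1) → ℤ, quo 1 u = u := fun u => blk_one u
  simp only [hq1, Nat.cast_one, one_pow, one_mul] at hE4
  have hE4L := tsum_env4_le (d := d) hL hκ c₁ c₂ c₃ c₄
  -- summability of the summand from the (crude) pointwise bounds
  have hpt : ∀ x, ‖ρ x * S x‖ ≤ (aρ * (L : ℝ) ^ (d + 1) * K) *
      (E (quo L x) c₁ * E (quo L x) c₂ * E (quo L x) c₃ * E (quo L x) c₄) := fun x => by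
    rw [Real.norm_eq_abs, abs_mul]
    calc |ρ x| * |S x| ≤ (aρ * (L : ℝ) ^ (d + 1) * E (quo L x) c₃) * (K * (E (quo L x) c₁ * E (quo L x) c₂ * E (quo L x) c₄)) :=
          mul_le_mul (hρx x) (hSx x) (abs_nonneg _) (by positivity)
      _ = _ := by ring
  have hsum : Summable fun x => ρ x * S x :=
    Summable.of_norm_bounded (hE4L.1.mul_left (aρ * (L : ℝ) ^ (d + 1) * K)) hpt
  refine ⟨hsum, ?_⟩
  -- re-block the `x`-sum
  rw [tsum_blocks (N := L) hsum]
  -- block by block: the slots' bound is constant on the block, the kernel weight gives its block mass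
  have hblk : ∀ c : Fin (d + 1) → ℤ,
      ‖∑ t ∈ box (d + 1) L, ρ ((L : ℤ) • c + toSite t) * S ((L : ℤ) • c + toSite t)‖
        ≤ (aρ * (L : ℝ) ^ (d + 1) * K) * (E c c₁ * E c c₂ * E c c₃ * E c c₄) := fun c => by
    rw [Real.norm_eq_abs]
    calc |∑ t ∈ box (d + 1) L, ρ ((L : ℤ) • c + toSite t) * S ((L : ℤ) • c + toSite t)|
        ≤ ∑ t ∈ box (d + 1) L, |ρ ((L : ℤ) • c + toSite t) * S ((L : ℤ) • c + toSite t)| := Finset.abs_sum_le_sum_abs _ _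
      _ ≤ ∑ t ∈ box (d + 1) L, |ρ ((L : ℤ) • c + toSite t)| * (K * (E c c₁ * E c c₂ * E c c₄)) :=
          Finset.sum_le_sum fun t ht => by
            rw [abs_mul]
            have h := hSx ((L : ℤ) • c + toSite t)
            rw [quo_zsmul_add_toSite c ht] at h
            exact mul_le_mul_of_nonneg_left h (abs_nonneg _)
      _ = (∑ t ∈ box (d + 1) L, |ρ ((L : ℤ) • c + toSite t)|) * (K * (E c c₁ * E c c₂ * E c c₄)) := by rw [Finset.sum_mul]
      _ ≤ (aρ * (L : ℝ) ^ (d + 1) * E c c₃) * (K * (E c c₁ * E c c₂ * E c c₄)) :=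
          mul_le_mul_of_nonneg_right (hρ₁ c) (by positivity)
      _ = _ := by ring
  have hs := hE4.1.mul_left (aρ * (L : ℝ) ^ (d + 1) * K)
  have hb := tsum_of_norm_bounded hs.hasSum hblk
  rw [Real.norm_eq_abs, tsum_mul_left] at hb
  refine hb.trans ?_
  calc aρ * (L : ℝ) ^ (d + 1) * K * ∑' c, E c c₁ * E c c₂ * E c c₃ * E c c₄
      ≤ aρ * (L : ℝ) ^ (d + 1) * K * (Zl (d + 1) (κ₀ / (2 * ((d : ℝ) + 1))) *
          Real.exp (-(κ₀ / 6) * (supNorm (c₂ - c₁) + supNorm (c₃ - c₁) + supNorm (c₄ - c₁)))) :=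
        mul_le_mul_of_nonneg_left hE4.2 (by positivity)
    _ = _ := by rw [hK]; ring

end Sup

end Summit.QuantumFields.BalabanUV.Beta.GAN24.ThreeLegSupBoundBlockL1

end
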